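import Summits.HodgeConjecture.HodgeConjecture.Cruxes.BlochSeedDiscOne.BoxIdentity

set_option linter.dupNamespace false

/-!
# BoxCap — the BOXCAP capacity law and the general box laws in the kernel (pen memos `BOXCAP-negation-g22.md`, `FPOFF-negation-g22.md`; leaf file)

LADDER HodgeAV · SUB-LINE `stmt-HodgeConjecture-18881` (`BlochSeedDiscOne`) · CENSUS-NEUTRAL (letter-model class arithmetic only;
nothing here bears on HC ∕ HC_CM ∕ HC_AV ∕ H2 ∕ 18881 ∕ 30548; census row ◇₈ r3 j305149 unchanged).  Author: plan-lens-HodgeAV-negation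
g22 (B136-AUDIT pen), 2026-08-31.  Imports `BoxIdentity` v3 only (frozen for this seat — hence a NEW leaf).

THE LAW (memo §1, officer idea-crit-6 g23 AUDIT BLOCK 13 ✓ ×2, BLOCK 16 «co-level-free» ✓).  For a design `D` on the height-`hgt` alphabet
with clause (A1e), `μ ≠ 0`, and EVERY SUPPORTED N CELL HUBBED (`NHubbed`, the binder (M2)):

* `linZN_psi_eq_zero`   — the N side is ψ-dead at every box (a hub letter kills every box, `slab_hub`);
* `sigma_eq_neg_pmass`  — `Sigma hgt D = − Σ_P m·ρ` (`ρ = ∏_f (hgt − a_f)`; the hub has `ρ = 0`), i.e. `S := Σ_P m·ρ = −σ`;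
* `pbox_mass_eq`        — on every box `x`: `2·Σ_P m·ψ_x = Re(i^{|x|} μ) + 2·S` (the class-constant P box mass, memo §1 (2));
* `eight_le_pmass`      — `S ≥ 8`;
* `slab_good`           — an AXIS letter `ℓ` (`x = 0 ∨ y = 0`) on the alphabet has `slab_s(ℓ) = 2·(hgt − a)` at the two phases
                           `s = dir ℓ + 1, dir ℓ + 2` (memo §1 (3): the slab pattern `(0, 2w, 2w, 0)` of a null axis letter of ANY co-level `w`);
* `psi_goodBox`         — for an axis cell `c` and any target class `k` the explicit box `goodBox c k` has class `k` and
                           `ψ_(goodBox c k)(c) = 16·ρ(c)` (memo §1 (3): an axis cell meets a box of EVERY class with weight `16·dep`);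
* `boxcap`              — **BOXCAP**: for every P entry `(c, m)` with `0 < m` and `c` an axis cell,
                           `16·m·ρ(c) + 8 ≤ S`, i.e. `m·dep(c) ≤ (S − 8)∕16` (memo §1 (4); on the alphabet `ρ(c) = dep(c) = ∏_f colevel`).

* §6 (plate item (P3) of director R19.724 (2) ∕ dual (K)): `HubfreePAxis` (displayed binder: hub-free supported P cells are axis cells =
  the ledger's (B)+(Bu)), `rho_pos_iff_nohub`, `exists_rho_pos`, **`pmass_ge_24`** (`S ≥ 24`, i.e. `E = −S ≤ −24`: «E ≥ −8 impossible»), and the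
  HUB-FREE MASS LAW **`sixteen_pmass_le`**: `16·S ≤ (S − 8)·Σ_P m·[ρ > 0]` (every unit of dep-mass sits on a hub-free cell of capacity
  `≤ (S − 8)∕16`), the input of dual's arithmetic close (P4) (`q = 3 ⇒ HF ≥ 24`, `q = 4 ⇒ 32`, `q = 5 ⇒ 20`, …).

* §7 ((F-Poff), director R19.727 (4) ∕ R19.728; memo `FPOFF-negation-g22.md`): the GENERAL BOX LAWS for EVERY supported P cell, off-axis
  letters included — `term_le_pbox` (`m·ψ_x(c) ≤ W_P(x)`), **`cap_law`** (`∃` good class `k`: `m·ψ_x(c) + 8 ≤ S` on every box of class `k`),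
  `pbox_good_class`, `pbox_pair` ∕ **`pair_law`** ∕ `pair_law₂` (`W_P(x) + W_P(x') = 2S` for opposite classes: `m·ψ_x(c) + m·ψ_x'(c) ≤ 2S`,
  class-free), and the GRANULARITY LAWS `dvd_two_pmass`, `slab_axis_cases` ∕ `slab_axis_dvd` ∕ `psi_axis_dvd` (`ψ_x ∈ {0, 16ρ}` on axis cells),
  `dvd_two_pmass_of_axisP`, **`sixteen_dvd_pmass_of_even_dep`** ∕ `pmass_ne_40_of_even_dep` (all hub-free P axis of even dep ⇒ `16 ∣ S`,
  so the shell-4 integer point «hub-free P = Auuu × 20, S = 40» is dead).  Per cell SHAPE the two laws give the capacity table of the memo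
  (`m(c) ≤ CAP(c, S)`; 39 of the 40 off-axis hub-free P shapes of the shell-4 room have `CAP = 0` at `S = 40`, the tail is `Buuu`, `m ≤ 1`).

Nothing about shell 3, co-level ≤ 2 or the fine room enters: the laws are alphabet-wide (anomaly NOTE l.14160, officer BLOCK 16).
v1 742f048c69d70f72 @667132b7ca17 (§1–§5); v2 959bbb0636396cc8 @e96120440c82 = v1 + §6; v3 = v2 + §7.
-/

namespace Summit.HodgeConjecture.HodgeConjecture.Cruxes.BlochSeedDiscOne.BoxCap

open Summit.HodgeConjecture.HodgeConjecture.Cruxes.BlochSeedDiscOne.DepthBoundA4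
open Summit.HodgeConjecture.HodgeConjecture.Cruxes.BlochSeedDiscOne.BoxIdentity

/-! ## §1 Hubbed N side: ψ-dead and ρ-dead -/

/-- (M2): every supported N cell carries the hub letter `(hgt; 0, 0)` at some slot. -/
def NHubbed (hgt : ℤ) (D : Design) : Prop := ∀ c ∈ D.suppN, ∃ f : Fin 4, c f = Letter.hub hgt

/-- An AXIS cell: every letter lies on an axis (`x = 0 ∨ y = 0`; the hub itself is allowed). -/
def AxisCell (c : Cell) : Prop := ∀ f : Fin 4, (c f).x = 0 ∨ (c f).y = 0

theorem psi_eq_zero_of_hub (hgt : ℤ) (x : Fin 4 → Fin 4) (c : Cell) (f : Fin 4) (hf : c f = Letter.hub hgt) :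
    psi hgt x c = 0 := by
  unfold psi
  exact Finset.prod_eq_zero (Finset.mem_univ f) (by rw [hf]; exact slab_hub hgt (x f))

theorem rho_eq_zero_of_hub (hgt : ℤ) (c : Cell) (f : Fin 4) (hf : c f = Letter.hub hgt) : rho hgt c = 0 := by
  unfold rho
  exact Finset.prod_eq_zero (Finset.mem_univ f) (by rw [hf]; simp [Letter.hub])

theorem linZN_psi_eq_zero (hgt : ℤ) (D : Design) (hM2 : NHubbed hgt D) (x : Fin 4 → Fin 4) :
    linZ D.N (psi hgt x) = 0 := by
  refine linZ_eq_zero_of_supp _ _ fun cm hcm hpos => ?_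
  obtain ⟨c, m⟩ := cm
  obtain ⟨f, hf⟩ := hM2 c ((mem_suppN_iff D c).2 ⟨m, hcm, hpos⟩)
  exact psi_eq_zero_of_hub hgt x c f hf

theorem linZN_rho_eq_zero (hgt : ℤ) (D : Design) (hM2 : NHubbed hgt D) : linZ D.N (rho hgt) = 0 := by
  refine linZ_eq_zero_of_supp _ _ fun cm hcm hpos => ?_
  obtain ⟨c, m⟩ := cm
  obtain ⟨f, hf⟩ := hM2 c ((mem_suppN_iff D c).2 ⟨m, hcm, hpos⟩)
  exact rho_eq_zero_of_hub hgt c f hf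

/-- Under (M2): `σ = −S` with `S = Σ_P m·ρ`. -/
theorem sigma_eq_neg_pmass (hgt : ℤ) (D : Design) (hM2 : NHubbed hgt D) :
    BoxIdentity.Sigma hgt D = -linZ D.P (rho hgt) := by
  unfold BoxIdentity.Sigma
  rw [linZN_rho_eq_zero hgt D hM2]
  ring

/-- Memo §1 (2): the P box mass is class-constant, `2·W_P(x) = Re(i^{|x|} μ) + 2·S`. -/
theorem pbox_mass_eq (hgt : ℤ) (D : Design) (hA : A1e D) (hM2 : NHubbed hgt D) (x : Fin 4 → Fin 4) :
    2 * linZ D.P (psi hgt x) = (ipow (wt x) * D.mu).re + 2 * linZ D.P (rho hgt) := by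
  have h := linZP_of_Ndead hgt D hA x (linZN_psi_eq_zero hgt D hM2 x)
  rw [sigma_eq_neg_pmass hgt D hM2] at h
  linarith

/-- Under (M2), `μ ≠ 0`: `S ≥ 8`. -/
theorem eight_le_pmass (hgt : ℤ) (D : Design) (hO : D.OnAlphabet hgt) (hA : A1e D) (hμ : D.mu ≠ 0)
    (hM2 : NHubbed hgt D) : 8 ≤ linZ D.P (rho hgt) := by
  obtain ⟨k, hk⟩ := exists_good_class hgt D hO hA hμ
  have h := pbox_mass_eq hgt D hA hM2 ![k, 0, 0, 0]
  rw [wt_single] at h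
  have hnn := linZP_psi_nonneg hgt D hO ![k, 0, 0, 0]
  linarith

/-! ## §2 The box pattern of an axis letter -/

/-- The direction (phase) of an axis letter: `0, 1, 2, 3` for `β` on the rays `+1, +i, −1, −i` (the hub gets `0`). -/
def dir (ℓ : Letter) : Fin 4 :=
  if ℓ.y = 0 ∧ 0 ≤ ℓ.x then 0 else if ℓ.x = 0 ∧ 0 ≤ ℓ.y then 1 else if ℓ.y = 0 then 2 else 3

/-- `good d s`: phase `s ∈ {d + 1, d + 2}` — the two phases at which a direction-`d` axis letter has slab `2w`. -/
def good : Fin 4 → Fin 4 → Bool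
  | 0, 1 => true | 0, 2 => true
  | 1, 2 => true | 1, 3 => true
  | 2, 3 => true | 2, 0 => true
  | 3, 0 => true | 3, 1 => true
  | _, _ => false

theorem good_add_one (d : Fin 4) : good d (d + 1) = true := by fin_cases d <;> decide
theorem good_add_two (d : Fin 4) : good d (d + 1 + 1) = true := by fin_cases d <;> decide

/-- Memo §1 (3), one letter: an axis letter on the alphabet has `slab_s = 2·(hgt − a)` at both good phases of its direction. -/
theorem slab_good (hgt : ℤ) (ℓ : Letter) (hℓ : ℓ.OnAlphabet hgt) (hax : ℓ.x = 0 ∨ ℓ.y = 0) (s : Fin 4)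
    (hs : good (dir ℓ) s = true) : slab hgt s ℓ = 2 * (hgt - ℓ.a) := by
  obtain ⟨hh, -⟩ := hℓ
  unfold Letter.height at hh
  have ax := le_abs_self ℓ.x
  have ax' := neg_abs_le ℓ.x
  have ay := le_abs_self ℓ.y
  have ay' := neg_abs_le ℓ.y
  unfold dir at hs
  split_ifs at hs with h1 h2 h3
  · obtain ⟨hy, hx⟩ := h1
    have hxa : |ℓ.x| = ℓ.x := abs_of_nonneg hx
    have hya : |ℓ.y| = 0 := by rw [hy, abs_zero]
    fin_cases s <;> simp [good] at hs <;> simp [slab, spro] <;> omega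
  · obtain ⟨hx, hy⟩ := h2
    have hya : |ℓ.y| = ℓ.y := abs_of_nonneg hy
    have hxa : |ℓ.x| = 0 := by rw [hx, abs_zero]
    fin_cases s <;> simp [good] at hs <;> simp [slab, spro] <;> omega
  · have hx : ℓ.x < 0 := by
      rcases hax with hx0 | hy0
      · exact absurd ⟨hx0, by rw [h3]⟩ h2
      · by_contra hcon
        exact h1 ⟨h3, not_lt.mp hcon⟩
    have hxa : |ℓ.x| = -ℓ.x := abs_of_neg hx
    have hya : |ℓ.y| = 0 := by rw [h3, abs_zero]
    fin_cases s <;> simp [good] at hs <;> simp [slab, spro] <;> omega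
  · have hx0 : ℓ.x = 0 := by
      rcases hax with hx0 | hy0
      · exact hx0
      · exact absurd hy0 h3
    have hy : ℓ.y < 0 := by
      by_contra hcon
      exact h2 ⟨hx0, not_lt.mp hcon⟩
    have hya : |ℓ.y| = -ℓ.y := abs_of_neg hy
    have hxa : |ℓ.x| = 0 := by rw [hx0, abs_zero]
    fin_cases s <;> simp [good] at hs <;> simp [slab, spro] <;> omega

/-! ## §3 A box of every class through an axis cell -/

/-- `bump j f = 1` for the first `j` slots, else `0`. -/
def bump (j f : Fin 4) : Fin 4 := if f.val < j.val then 1 else 0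

theorem bump_zero_or_one (j f : Fin 4) : bump j f = 0 ∨ bump j f = 1 := by
  unfold bump; split_ifs <;> simp

theorem bump_sum (j : Fin 4) : bump j 0 + bump j 1 + bump j 2 + bump j 3 = j := by
  fin_cases j <;> decide

theorem four_ones_eq_zero : (1 + 1 + 1 + 1 : Fin 4) = 0 := by decide

/-- The explicit box of class `k` through the axis cell `c`: phases `dir(c_f) + 1`, the first `j` of them bumped by one more,
`j := k − Σ_f (dir(c_f) + 1)`. -/
def goodBox (c : Cell) (k : Fin 4) : Fin 4 → Fin 4 :=
  fun f => dir (c f) + 1 + bump (k - wt fun g => dir (c g)) f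

theorem wt_goodBox (c : Cell) (k : Fin 4) : wt (goodBox c k) = k := by
  have hb := bump_sum (k - wt fun g => dir (c g))
  calc wt (goodBox c k)
      = (wt fun g => dir (c g)) + (bump (k - wt fun g => dir (c g)) 0 + bump (k - wt fun g => dir (c g)) 1 +
          bump (k - wt fun g => dir (c g)) 2 + bump (k - wt fun g => dir (c g)) 3) + (1 + 1 + 1 + 1) := by
        simp only [wt, goodBox]; abel
    _ = (wt fun g => dir (c g)) + (k - wt fun g => dir (c g)) + 0 := by rw [hb, four_ones_eq_zero]
    _ = k := by abel

theorem good_goodBox (c : Cell) (k : Fin 4) (f : Fin 4) : good (dir (c f)) (goodBox c k f) = true := by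
  unfold goodBox
  rcases bump_zero_or_one (k - wt fun g => dir (c g)) f with h | h
  · rw [h, add_zero]; exact good_add_one _
  · rw [h]; exact good_add_two _

/-- Memo §1 (3), one cell: `ψ_(goodBox c k)(c) = 16·ρ(c)` for an axis cell on the alphabet. -/
theorem psi_goodBox (hgt : ℤ) (c : Cell) (hc : ∀ f : Fin 4, (c f).OnAlphabet hgt) (hax : AxisCell c) (k : Fin 4) :
    psi hgt (goodBox c k) c = 16 * rho hgt c := by
  have hs : ∀ f : Fin 4, slab hgt (goodBox c k f) (c f) = 2 * (hgt - (c f).a) :=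
    fun f => slab_good hgt (c f) (hc f) (hax f) _ (good_goodBox c k f)
  simp only [psi, rho, Fin.prod_univ_four, hs]
  ring

/-! ## §4 One term under the sum -/

theorem term_le_linZ (L : List (Cell × ℕ)) (φ : Cell → ℤ) (hφ : ∀ cm ∈ L, 0 < cm.2 → 0 ≤ φ cm.1)
    {cm : Cell × ℕ} (hcm : cm ∈ L) : (cm.2 : ℤ) * φ cm.1 ≤ linZ L φ := by
  induction L with
  | nil => simp at hcm
  | cons a t ih =>
    rw [linZ_cons]
    have hφt : ∀ cm ∈ t, 0 < cm.2 → 0 ≤ φ cm.1 := fun cm h => hφ cm (List.mem_cons_of_mem _ h)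
    have ht : 0 ≤ linZ t φ := linZ_nonneg t φ hφt
    rcases List.mem_cons.mp hcm with rfl | hmem
    · linarith
    · have h1 := ih hφt hmem
      have ha : 0 ≤ (a.2 : ℤ) * φ a.1 := by
        rcases Nat.eq_zero_or_pos a.2 with h0 | hpos
        · rw [h0]; simp
        · exact mul_nonneg (by exact_mod_cast Nat.zero_le _) (hφ a List.mem_cons_self hpos)
      linarith

/-! ## §5 BOXCAP -/

/-- **BOXCAP (memo `BOXCAP-negation-g22.md` §1 (4), alphabet-wide).**  On the height-`hgt` alphabet with clause (A1e), `μ ≠ 0` and every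
supported N cell hubbed: every P entry `(c, m)`, `0 < m`, whose cell is an AXIS cell satisfies `16·m·ρ(c) + 8 ≤ S = Σ_P m·ρ`
(equivalently `m·dep(c) ≤ (S − 8)∕16`, `dep = ρ = ∏_f colevel` on the alphabet).  Proof = memo §1: pick the class `k` with
`Re(i^k μ) ≤ −16` (`exists_good_class`), the box `goodBox c k` of that class through `c` (`ψ = 16ρ` there), bound the single term by the
class-constant P box mass `W_P = S + Re(i^k μ)∕2 ≤ S − 8`. -/
theorem boxcap (hgt : ℤ) (D : Design) (hO : D.OnAlphabet hgt) (hA : A1e D) (hμ : D.mu ≠ 0) (hM2 : NHubbed hgt D)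
    {c : Cell} {m : ℕ} (hcm : (c, m) ∈ D.P) (hpos : 0 < m) (hax : AxisCell c) :
    16 * (m : ℤ) * rho hgt c + 8 ≤ linZ D.P (rho hgt) := by
  obtain ⟨k, hk⟩ := exists_good_class hgt D hO hA hμ
  have hsupp : ∀ c' ∈ D.suppP, ∀ f : Fin 4, (c' f).OnAlphabet hgt :=
    fun c' hc' f => hO c' (List.mem_append.2 (Or.inr hc')) f
  have hc : c ∈ D.suppP := (mem_suppP_iff D c).2 ⟨m, hcm, hpos⟩
  set x := goodBox c k with hx
  have hpsi : psi hgt x c = 16 * rho hgt c := psi_goodBox hgt c (hsupp c hc) hax k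
  have hterm : (m : ℤ) * psi hgt x c ≤ linZ D.P (psi hgt x) := by
    refine term_le_linZ D.P (psi hgt x) (fun cm hcm' hpos' => ?_) hcm
    obtain ⟨c', m'⟩ := cm
    exact psi_nonneg hgt x c' (hsupp c' ((mem_suppP_iff D c').2 ⟨m', hcm', hpos'⟩))
  have hbox := pbox_mass_eq hgt D hA hM2 x
  rw [hx, wt_goodBox, ← hx] at hbox
  rw [hpsi] at hterm
  nlinarith [hbox, hterm, hk]

/-- BOXCAP, capacity form per cell TYPE: if `16·ρ(c) > S − 8` no supported axis P cell of that shape exists. -/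
theorem no_axisP_of_rho_gt (hgt : ℤ) (D : Design) (hO : D.OnAlphabet hgt) (hA : A1e D) (hμ : D.mu ≠ 0) (hM2 : NHubbed hgt D)
    {c : Cell} (hax : AxisCell c) (hbig : linZ D.P (rho hgt) < 16 * rho hgt c + 8) : c ∉ D.suppP := by
  intro hc
  obtain ⟨m, hcm, hpos⟩ := (mem_suppP_iff D c).1 hc
  have h := boxcap hgt D hO hA hμ hM2 hcm hpos hax
  have h1 : (1 : ℤ) ≤ m := by exact_mod_cast hpos
  have hρ : 0 ≤ rho hgt c := by
    unfold rho
    exact Finset.prod_nonneg fun f _ => by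
      have := (hO c (List.mem_append.2 (Or.inr hc)) f).1
      unfold Letter.height at this
      have := abs_nonneg (c f).x; have := abs_nonneg (c f).y
      linarith
  nlinarith

/-! ## §6 (P3) Consequences for the plate `shell3_empty_of_binders` (director R19.724 (2), dual memo v5 ADDENDUM 4) -/

/-- `ρ ≥ 0` on the alphabet. -/
theorem rho_nonneg (hgt : ℤ) (c : Cell) (hc : ∀ f : Fin 4, (c f).OnAlphabet hgt) : 0 ≤ rho hgt c := by
  unfold rho
  exact Finset.prod_nonneg fun f _ => by
    have hh := (hc f).1
    unfold Letter.height at hh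
    have := abs_nonneg (c f).x
    have := abs_nonneg (c f).y
    linarith

/-- On the alphabet: `ρ(c) > 0` iff no letter of `c` is the hub. -/
theorem rho_pos_iff_nohub (hgt : ℤ) (c : Cell) (hc : ∀ f : Fin 4, (c f).OnAlphabet hgt) :
    0 < rho hgt c ↔ ∀ f : Fin 4, c f ≠ Letter.hub hgt := by
  constructor
  · intro h f hf
    have := rho_eq_zero_of_hub hgt c f hf
    omega
  · intro h
    unfold rho
    exact Finset.prod_pos fun f _ => by
      obtain ⟨hh, ha⟩ := hc f
      unfold Letter.height at hh
      have hx := abs_nonneg (c f).x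
      have hy := abs_nonneg (c f).y
      rcases lt_or_eq_of_le (show (c f).a ≤ hgt by linarith) with hlt | heq
      · linarith
      · exfalso
        apply h f
        have hx0 : (c f).x = 0 := abs_eq_zero.mp (by linarith)
        have hy0 : (c f).y = 0 := abs_eq_zero.mp (by linarith)
        cases hcf : c f
        simp only [hcf] at heq hx0 hy0
        simp only [Letter.hub, heq, hx0, hy0]

/-- DISPLAYED BINDER ((B)+(Bu) of the shell-3 ledger, R19.718): every hub-free supported P cell is an axis cell. -/
def HubfreePAxis (hgt : ℤ) (D : Design) : Prop :=
  ∀ c ∈ D.suppP, (∀ f : Fin 4, c f ≠ Letter.hub hgt) → AxisCell c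

/-- Under (M2) and `μ ≠ 0` some supported P cell carries positive dep-mass (`S ≥ 8 > 0`). -/
theorem exists_rho_pos (hgt : ℤ) (D : Design) (hO : D.OnAlphabet hgt) (hA : A1e D) (hμ : D.mu ≠ 0) (hM2 : NHubbed hgt D) :
    ∃ c : Cell, ∃ m : ℕ, (c, m) ∈ D.P ∧ 0 < m ∧ 0 < rho hgt c := by
  rcases em (∃ c : Cell, ∃ m : ℕ, (c, m) ∈ D.P ∧ 0 < m ∧ 0 < rho hgt c) with h | h
  · exact h
  · exfalso
    have h0 : linZ D.P (rho hgt) = 0 := by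
      refine linZ_eq_zero_of_supp _ _ fun cm hcm hpos => ?_
      obtain ⟨c, m⟩ := cm
      have hc : c ∈ D.suppP := (mem_suppP_iff D c).2 ⟨m, hcm, hpos⟩
      have hnn := rho_nonneg hgt c fun f => hO c (List.mem_append.2 (Or.inr hc)) f
      rcases lt_or_eq_of_le hnn with hlt | heq
      · exact absurd ⟨c, m, hcm, hpos, hlt⟩ h
      · exact heq.symm
    have h8 := eight_le_pmass hgt D hO hA hμ hM2
    omega

/-- **(P3)** Under (M2), the binder `HubfreePAxis` and `μ ≠ 0`: `S ≥ 24` (so `E = −S ≤ −24`; «`E ≥ −8` is impossible»). -/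
theorem pmass_ge_24 (hgt : ℤ) (D : Design) (hO : D.OnAlphabet hgt) (hA : A1e D) (hμ : D.mu ≠ 0) (hM2 : NHubbed hgt D)
    (hB : HubfreePAxis hgt D) : 24 ≤ linZ D.P (rho hgt) := by
  obtain ⟨c, m, hcm, hpos, hρ⟩ := exists_rho_pos hgt D hO hA hμ hM2
  have hc : c ∈ D.suppP := (mem_suppP_iff D c).2 ⟨m, hcm, hpos⟩
  have hal : ∀ f : Fin 4, (c f).OnAlphabet hgt := fun f => hO c (List.mem_append.2 (Or.inr hc)) f
  have hax : AxisCell c := hB c hc ((rho_pos_iff_nohub hgt c hal).1 hρ)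
  have hb := boxcap hgt D hO hA hμ hM2 hcm hpos hax
  have h1 : (1 : ℤ) ≤ m := by exact_mod_cast hpos
  nlinarith

/-- Indicator of the hub-free cells (`ρ > 0`). -/
def hfInd (hgt : ℤ) (c : Cell) : ℤ := if 0 < rho hgt c then 1 else 0

/-- **HUB-FREE MASS LAW (input of (P4)).** `16·S ≤ (S − 8)·Σ_P m·[ρ > 0]`: all dep-mass sits on hub-free cells, each of capacity
`ρ ≤ m·ρ ≤ (S − 8)∕16` by `boxcap`.  (`S = 24 ⇒ HF ≥ 24`, `S = 32 ⇒ HF ≥ 22`, `S = 40 ⇒ HF ≥ 20`; with the integrality `dep ∣`-free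
form `m·dep ≤ ⌊(S−8)∕16⌋` the memo's sharper `HF ≥ S∕dep_max(q)` follows in (P4).) -/
theorem sixteen_pmass_le (hgt : ℤ) (D : Design) (hO : D.OnAlphabet hgt) (hA : A1e D) (hμ : D.mu ≠ 0) (hM2 : NHubbed hgt D)
    (hB : HubfreePAxis hgt D) :
    16 * linZ D.P (rho hgt) ≤ (linZ D.P (rho hgt) - 8) * linZ D.P (hfInd hgt) := by
  have key : ∀ cm ∈ D.P, 0 < cm.2 → 16 * rho hgt cm.1 ≤ (linZ D.P (rho hgt) - 8) * hfInd hgt cm.1 := by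
    intro cm hcm hpos
    obtain ⟨c, m⟩ := cm
    have hc : c ∈ D.suppP := (mem_suppP_iff D c).2 ⟨m, hcm, hpos⟩
    have hal : ∀ f : Fin 4, (c f).OnAlphabet hgt := fun f => hO c (List.mem_append.2 (Or.inr hc)) f
    by_cases hρ : 0 < rho hgt c
    · have hax : AxisCell c := hB c hc ((rho_pos_iff_nohub hgt c hal).1 hρ)
      have hb := boxcap hgt D hO hA hμ hM2 hcm hpos hax
      have h1 : (1 : ℤ) ≤ m := by exact_mod_cast hpos
      simp only [hfInd, hρ, if_true, mul_one]
      nlinarith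
    · have h0 : rho hgt c = 0 := le_antisymm (not_lt.mp hρ) (rho_nonneg hgt c hal)
      simp [hfInd, h0]
  have hm := linZ_mono D.P (fun c => 16 * rho hgt c) (fun c => (linZ D.P (rho hgt) - 8) * hfInd hgt c) key
  rw [linZ_const_mul, linZ_const_mul] at hm
  exact hm

/-- The same law with the per-type sharpening used by the memo (§1 (5)): if every hub-free supported P cell has `ρ ≤ R` then
`S ≤ R·Σ_P m·[ρ > 0]` — e.g. `R = 1` at `q ∈ {3, 4}` (only `u⁴` fits), `R = 2` at `q ∈ {5, …, 8}`. -/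
theorem pmass_le_of_rho_le (hgt : ℤ) (D : Design) (hO : D.OnAlphabet hgt) (R : ℤ)
    (hR : ∀ c ∈ D.suppP, 0 < rho hgt c → rho hgt c ≤ R) :
    linZ D.P (rho hgt) ≤ R * linZ D.P (hfInd hgt) := by
  have key : ∀ cm ∈ D.P, 0 < cm.2 → rho hgt cm.1 ≤ R * hfInd hgt cm.1 := by
    intro cm hcm hpos
    obtain ⟨c, m⟩ := cm
    have hc : c ∈ D.suppP := (mem_suppP_iff D c).2 ⟨m, hcm, hpos⟩
    have hal : ∀ f : Fin 4, (c f).OnAlphabet hgt := fun f => hO c (List.mem_append.2 (Or.inr hc)) f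
    by_cases hρ : 0 < rho hgt c
    · simp only [hfInd, hρ, if_true, mul_one]
      exact hR c hc hρ
    · have h0 : rho hgt c = 0 := le_antisymm (not_lt.mp hρ) (rho_nonneg hgt c hal)
      simp [hfInd, h0]
  have hm := linZ_mono D.P (rho hgt) (fun c => R * hfInd hgt c) key
  rw [linZ_const_mul] at hm
  exact hm

/-- `boxcap` read as a capacity bound on `ρ` itself: a supported axis P cell has `16·ρ(c) ≤ S − 8`. -/
theorem rho_le_of_supp (hgt : ℤ) (D : Design) (hO : D.OnAlphabet hgt) (hA : A1e D) (hμ : D.mu ≠ 0) (hM2 : NHubbed hgt D)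
    (hB : HubfreePAxis hgt D) {c : Cell} (hc : c ∈ D.suppP) (hρ : 0 < rho hgt c) :
    16 * rho hgt c ≤ linZ D.P (rho hgt) - 8 := by
  obtain ⟨m, hcm, hpos⟩ := (mem_suppP_iff D c).1 hc
  have hal : ∀ f : Fin 4, (c f).OnAlphabet hgt := fun f => hO c (List.mem_append.2 (Or.inr hc)) f
  have hax : AxisCell c := hB c hc ((rho_pos_iff_nohub hgt c hal).1 hρ)
  have hb := boxcap hgt D hO hA hμ hM2 hcm hpos hax
  have h1 : (1 : ℤ) ≤ m := by exact_mod_cast hpos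
  nlinarith

/-! ## §7 (F-Poff) GENERAL BOX LAWS for every supported P cell (memo `FPOFF-negation-g22.md`; director R19.727 (4) ∕ R19.728)

Under (M2) (every supported N cell hubbed), clause (A1e) and the alphabet, the class-constant P box mass
`W_P(x) = S + Re(i^{|x|} μ)∕2` (`pbox_mass_eq`) bounds every single term `m·ψ_x(c)` (`term_le_pbox`).  Two laws, height-free and
shape-free: the **CAP LAW** at the good class (`cap_law`; `boxcap` is its instance at the box `goodBox c k` of an axis cell, where
`ψ = 16ρ`) and the class-free **PAIR LAW** (`pair_law`: `W_P(x) + W_P(x') = 2S` whenever `|x'| = |x| + 2`).  For a cell shape with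
class maxima `M_j(c) = max_{|x| = j} ψ_x(c)` they give `m(c) ≤ CAP(c, S) := max_k min(⌊(S − 8)∕M_k⌋, ⌊2S∕(M_0 + M_2)⌋, ⌊2S∕(M_1 + M_3)⌋)`
— the memo's table (39 of the 40 off-axis hub-free P shapes of the shell-4 room have `CAP = 0` at `S = 40`; the tail is `Buuu` with
`m ≤ 1`).  The **GRANULARITY LAW** (`dvd_two_pmass`, `sixteen_dvd_pmass_of_even_dep`): a common divisor of all P terms at two boxes of
opposite classes divides `2S`; with all hub-free P cells axis (`HubfreePAxis`) and of even `dep`, `16 ∣ S` — so `S = 40` is impossible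
for the support «hub-free P = Auuu-cells» of the shell-4 integer point (R19.727 (4)). -/

/-- Every single P term is bounded by the P box mass: `m·ψ_x(c) ≤ W_P(x)` (all terms are `≥ 0` on the alphabet). -/
theorem term_le_pbox (hgt : ℤ) (D : Design) (hO : D.OnAlphabet hgt) (x : Fin 4 → Fin 4)
    {c : Cell} {m : ℕ} (hcm : (c, m) ∈ D.P) : (m : ℤ) * psi hgt x c ≤ linZ D.P (psi hgt x) := by
  refine term_le_linZ D.P (psi hgt x) (fun cm hcm' hpos' => ?_) hcm
  obtain ⟨c', m'⟩ := cm
  exact psi_nonneg hgt x c' fun f =>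
    hO c' (List.mem_append.2 (Or.inr ((mem_suppP_iff D c').2 ⟨m', hcm', hpos'⟩))) f

/-- `Re(i^{k+2} μ) = −Re(i^k μ)`. -/
theorem re_ipow_add_two (k : Fin 4) (D : Design) : (ipow (k + 2) * D.mu).re = -(ipow k * D.mu).re := by
  rw [ipow_add_two, neg_mul]
  simp

/-- **CAP LAW.**  There is a class `k` (the good class of `exists_good_class`, `Re(i^k μ) ≤ −16`) such that on EVERY box `x` of
class `k` every P entry `(c, m)` satisfies `m·ψ_x(c) + 8 ≤ S`. -/
theorem cap_law (hgt : ℤ) (D : Design) (hO : D.OnAlphabet hgt) (hA : A1e D) (hμ : D.mu ≠ 0) (hM2 : NHubbed hgt D) :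
    ∃ k : Fin 4, ∀ x : Fin 4 → Fin 4, wt x = k → ∀ (c : Cell) (m : ℕ), (c, m) ∈ D.P →
      (m : ℤ) * psi hgt x c + 8 ≤ linZ D.P (rho hgt) := by
  obtain ⟨k, hk⟩ := exists_good_class hgt D hO hA hμ
  refine ⟨k, fun x hx c m hcm => ?_⟩
  have hterm := term_le_pbox hgt D hO x hcm
  have hbox := pbox_mass_eq hgt D hA hM2 x
  rw [hx] at hbox
  linarith

/-- The good class caps the whole P box mass, and the opposite class is heavy: `W_P(x) + 8 ≤ S` for `|x| = k`,
`S + 8 ≤ W_P(x')` for `|x'| = k + 2`. -/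
theorem pbox_good_class (hgt : ℤ) (D : Design) (hO : D.OnAlphabet hgt) (hA : A1e D) (hμ : D.mu ≠ 0) (hM2 : NHubbed hgt D) :
    ∃ k : Fin 4, (∀ x : Fin 4 → Fin 4, wt x = k → linZ D.P (psi hgt x) + 8 ≤ linZ D.P (rho hgt)) ∧
      (∀ x : Fin 4 → Fin 4, wt x = k + 2 → linZ D.P (rho hgt) + 8 ≤ linZ D.P (psi hgt x)) := by
  obtain ⟨k, hk⟩ := exists_good_class hgt D hO hA hμ
  refine ⟨k, fun x hx => ?_, fun x hx => ?_⟩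
  · have hbox := pbox_mass_eq hgt D hA hM2 x
    rw [hx] at hbox
    linarith
  · have hbox := pbox_mass_eq hgt D hA hM2 x
    rw [hx, re_ipow_add_two] at hbox
    linarith

/-- `W_P(x) + W_P(x') = 2S` for boxes of opposite classes. -/
theorem pbox_pair (hgt : ℤ) (D : Design) (hA : A1e D) (hM2 : NHubbed hgt D) (x x' : Fin 4 → Fin 4)
    (hx : wt x' = wt x + 2) : linZ D.P (psi hgt x) + linZ D.P (psi hgt x') = 2 * linZ D.P (rho hgt) := by
  have h1 := pbox_mass_eq hgt D hA hM2 x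
  have h2 := pbox_mass_eq hgt D hA hM2 x'
  rw [hx, re_ipow_add_two] at h2
  linarith

/-- **PAIR LAW (class-free).**  For boxes `x, x'` of opposite classes every P entry has `m·ψ_x(c) + m·ψ_x'(c) ≤ 2S`. -/
theorem pair_law (hgt : ℤ) (D : Design) (hO : D.OnAlphabet hgt) (hA : A1e D) (hM2 : NHubbed hgt D)
    (x x' : Fin 4 → Fin 4) (hx : wt x' = wt x + 2) {c : Cell} {m : ℕ} (hcm : (c, m) ∈ D.P) :
    (m : ℤ) * psi hgt x c + (m : ℤ) * psi hgt x' c ≤ 2 * linZ D.P (rho hgt) := by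
  have h1 := term_le_pbox hgt D hO x hcm
  have h2 := term_le_pbox hgt D hO x' hcm
  have hp := pbox_pair hgt D hA hM2 x x' hx
  linarith

/-- PAIR LAW for two entries at once (distinct cells share the box budget): if `(c₁, m₁) ≠ (c₂, m₂)` are both in `P` … the list form
is `term_le_pbox` summed; the two-entry instance most used by the type LP is: one entry at `x`, another at `x'`. -/
theorem pair_law₂ (hgt : ℤ) (D : Design) (hO : D.OnAlphabet hgt) (hA : A1e D) (hM2 : NHubbed hgt D)
    (x x' : Fin 4 → Fin 4) (hx : wt x' = wt x + 2) {c₁ c₂ : Cell} {m₁ m₂ : ℕ} (h₁ : (c₁, m₁) ∈ D.P) (h₂ : (c₂, m₂) ∈ D.P) :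
    (m₁ : ℤ) * psi hgt x c₁ + (m₂ : ℤ) * psi hgt x' c₂ ≤ 2 * linZ D.P (rho hgt) := by
  have h1 := term_le_pbox hgt D hO x h₁
  have h2 := term_le_pbox hgt D hO x' h₂
  have hp := pbox_pair hgt D hA hM2 x x' hx
  linarith

/-- **GRANULARITY LAW.**  If an integer `g` divides every P term `ψ_x(c)` (of positive multiplicity) at a box `x` and at a box `x'`
of the opposite class, then `g ∣ 2S`. -/
theorem dvd_two_pmass (hgt : ℤ) (D : Design) (hA : A1e D) (hM2 : NHubbed hgt D) (g : ℤ) (x x' : Fin 4 → Fin 4)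
    (hx : wt x' = wt x + 2) (h : ∀ cm ∈ D.P, 0 < cm.2 → g ∣ psi hgt x cm.1)
    (h' : ∀ cm ∈ D.P, 0 < cm.2 → g ∣ psi hgt x' cm.1) : g ∣ 2 * linZ D.P (rho hgt) := by
  rw [← pbox_pair hgt D hA hM2 x x' hx]
  exact dvd_add (linZ_dvd_of_supp _ _ _ h) (linZ_dvd_of_supp _ _ _ h')

/-- An axis letter on the alphabet has `slab_t ∈ {0, 2·(hgt − a)}` at every phase `t`. -/
theorem slab_axis_cases (hgt : ℤ) (ℓ : Letter) (hℓ : ℓ.OnAlphabet hgt) (hax : ℓ.x = 0 ∨ ℓ.y = 0) (t : Fin 4) :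
    slab hgt t ℓ = 0 ∨ slab hgt t ℓ = 2 * (hgt - ℓ.a) := by
  obtain ⟨hh, -⟩ := hℓ
  unfold Letter.height at hh
  rcases hax with h0 | h0
  · have hxa : |ℓ.x| = 0 := by rw [h0, abs_zero]
    rcases le_or_gt 0 ℓ.y with hy | hy
    · have hya : |ℓ.y| = ℓ.y := abs_of_nonneg hy
      fin_cases t <;> simp [slab, spro] <;> omega
    · have hya : |ℓ.y| = -ℓ.y := abs_of_neg hy
      fin_cases t <;> simp [slab, spro] <;> omega
  · have hya : |ℓ.y| = 0 := by rw [h0, abs_zero]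
    rcases le_or_gt 0 ℓ.x with hx | hx
    · have hxa : |ℓ.x| = ℓ.x := abs_of_nonneg hx
      fin_cases t <;> simp [slab, spro] <;> omega
    · have hxa : |ℓ.x| = -ℓ.x := abs_of_neg hx
      fin_cases t <;> simp [slab, spro] <;> omega

/-- Hence `2·(hgt − a) ∣ slab_t` for an axis letter. -/
theorem slab_axis_dvd (hgt : ℤ) (ℓ : Letter) (hℓ : ℓ.OnAlphabet hgt) (hax : ℓ.x = 0 ∨ ℓ.y = 0) (t : Fin 4) :
    2 * (hgt - ℓ.a) ∣ slab hgt t ℓ := by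
  rcases slab_axis_cases hgt ℓ hℓ hax t with h | h
  · rw [h]; exact dvd_zero _
  · rw [h]

/-- An axis cell on the alphabet has `16·ρ(c) ∣ ψ_x(c)` at every box (`ψ_x(c) ∈ {0, 16ρ(c)}`). -/
theorem psi_axis_dvd (hgt : ℤ) (c : Cell) (hc : ∀ f : Fin 4, (c f).OnAlphabet hgt) (hax : AxisCell c) (x : Fin 4 → Fin 4) :
    16 * rho hgt c ∣ psi hgt x c := by
  have h16 : 16 * rho hgt c = ∏ f : Fin 4, 2 * (hgt - (c f).a) := by
    simp only [rho, Fin.prod_univ_four]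
    ring
  rw [h16]
  unfold psi
  exact Finset.prod_dvd_prod_of_dvd _ _ fun f _ => slab_axis_dvd hgt (c f) (hc f) (hax f) (x f)

/-- **GRANULARITY under `HubfreePAxis`.**  If every hub-free supported P cell is an axis cell and `g ∣ 16·ρ(c)` for each of them,
then `g ∣ 2S` (hubbed cells have `ψ ≡ 0`). -/
theorem dvd_two_pmass_of_axisP (hgt : ℤ) (D : Design) (hO : D.OnAlphabet hgt) (hA : A1e D) (hM2 : NHubbed hgt D)
    (hB : HubfreePAxis hgt D) (g : ℤ) (hg : ∀ c ∈ D.suppP, 0 < rho hgt c → g ∣ 16 * rho hgt c) :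
    g ∣ 2 * linZ D.P (rho hgt) := by
  have hsupp : ∀ c' ∈ D.suppP, ∀ f : Fin 4, (c' f).OnAlphabet hgt :=
    fun c' hc' f => hO c' (List.mem_append.2 (Or.inr hc')) f
  have key : ∀ x : Fin 4 → Fin 4, ∀ cm ∈ D.P, 0 < cm.2 → g ∣ psi hgt x cm.1 := by
    intro x cm hcm hpos
    obtain ⟨c, m⟩ := cm
    have hc : c ∈ D.suppP := (mem_suppP_iff D c).2 ⟨m, hcm, hpos⟩
    rcases em (∀ f : Fin 4, c f ≠ Letter.hub hgt) with hnh | hh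
    · have hρ : 0 < rho hgt c := (rho_pos_iff_nohub hgt c (hsupp c hc)).2 hnh
      exact dvd_trans (hg c hc hρ) (psi_axis_dvd hgt c (hsupp c hc) (hB c hc hnh) x)
    · simp only [not_forall, not_not] at hh
      obtain ⟨f, hf⟩ := hh
      show g ∣ psi hgt x c
      rw [psi_eq_zero_of_hub hgt x c f hf]
      exact dvd_zero _
  have hwt : wt ![2, 0, 0, 0] = wt ![0, 0, 0, 0] + 2 := by
    rw [wt_single, wt_single]; decide
  exact dvd_two_pmass hgt D hA hM2 g ![0, 0, 0, 0] ![2, 0, 0, 0] hwt (key _) (key _)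

/-- **The director's cell-law target (R19.727 (4)) is dead by granularity:** if every hub-free supported P cell is an axis cell of EVEN
`dep` (e.g. all of type `Auuu`, `ρ = 2`), then `16 ∣ S`; in particular `S = 40` is impossible. -/
theorem sixteen_dvd_pmass_of_even_dep (hgt : ℤ) (D : Design) (hO : D.OnAlphabet hgt) (hA : A1e D) (hM2 : NHubbed hgt D)
    (hB : HubfreePAxis hgt D) (heven : ∀ c ∈ D.suppP, 0 < rho hgt c → 2 ∣ rho hgt c) :
    16 ∣ linZ D.P (rho hgt) := by
  have h32 : (32 : ℤ) ∣ 2 * linZ D.P (rho hgt) := by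
    refine dvd_two_pmass_of_axisP hgt D hO hA hM2 hB 32 fun c hc hρ => ?_
    obtain ⟨r, hr⟩ := heven c hc hρ
    exact ⟨r, by rw [hr]; ring⟩
  omega

theorem pmass_ne_40_of_even_dep (hgt : ℤ) (D : Design) (hO : D.OnAlphabet hgt) (hA : A1e D) (hM2 : NHubbed hgt D)
    (hB : HubfreePAxis hgt D) (heven : ∀ c ∈ D.suppP, 0 < rho hgt c → 2 ∣ rho hgt c) :
    linZ D.P (rho hgt) ≠ 40 := by
  have h := sixteen_dvd_pmass_of_even_dep hgt D hO hA hM2 hB heven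
  omega


/-! ## §8 Per-cell totals (officer idea-crit-6 g24 AUDIT BLOCK 18 rider (R1); v3.1)

`Design.P : List (Cell × ℕ)` carries no `Nodup`, so §5–§7 bound each P ENTRY.  The type tables (memo `FPOFF-negation-g22.md`,
TABLE A of bus RESULT-13) want the per-CELL total `cellMult D.P c = Σ_{(c, m) ∈ P} m`; it obeys the same laws by the same summation
(all terms are `≥ 0` on the alphabet): `cellMult_le_linZ`, `cellMult_le_pbox`, and the per-cell CAP ∕ PAIR laws `cap_law_cell`,
`pair_law_cell`, `boxcap_cell`.  No digit of any table changes. -/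

/-- Total multiplicity of the cell `c` in an entry list. -/
def cellMult (L : List (Cell × ℕ)) (c : Cell) : ℕ := ((L.filter fun cm => cm.1 = c).map Prod.snd).sum

theorem cellMult_nil (c : Cell) : cellMult [] c = 0 := by simp [cellMult]

theorem cellMult_cons (a : Cell × ℕ) (t : List (Cell × ℕ)) (c : Cell) :
    cellMult (a :: t) c = (if a.1 = c then a.2 else 0) + cellMult t c := by
  unfold cellMult
  by_cases h : a.1 = c
  · simp [h]
  · simp [h]

/-- A single entry is at most the cell total. -/
theorem le_cellMult (L : List (Cell × ℕ)) {c : Cell} {m : ℕ} (hcm : (c, m) ∈ L) : m ≤ cellMult L c := by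
  induction L with
  | nil => simp at hcm
  | cons a t ih =>
    rw [cellMult_cons]
    rcases List.mem_cons.mp hcm with h | hmem
    · rw [← h]; simp
    · have := ih hmem; omega

/-- The per-cell total under the sum: `cellMult L c · φ c ≤ Σ_L m·φ` when all supported terms are `≥ 0`. -/
theorem cellMult_le_linZ (L : List (Cell × ℕ)) (φ : Cell → ℤ) (hφ : ∀ cm ∈ L, 0 < cm.2 → 0 ≤ φ cm.1) (c : Cell) :
    (cellMult L c : ℤ) * φ c ≤ linZ L φ := by
  induction L with
  | nil => simp [cellMult_nil, linZ_nil]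
  | cons a t ih =>
    rw [cellMult_cons, linZ_cons]
    have hφt : ∀ cm ∈ t, 0 < cm.2 → 0 ≤ φ cm.1 := fun cm h => hφ cm (List.mem_cons_of_mem _ h)
    have h1 := ih hφt
    have ha : 0 ≤ (a.2 : ℤ) * φ a.1 := by
      rcases Nat.eq_zero_or_pos a.2 with h0 | hpos
      · rw [h0]; simp
      · exact mul_nonneg (by exact_mod_cast Nat.zero_le _) (hφ a List.mem_cons_self hpos)
    by_cases h : a.1 = c
    · subst h
      rw [if_pos rfl]; push_cast; rw [add_mul]; linarith
    · rw [if_neg h, zero_add]; linarith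

/-- (R1) per-cell form of `term_le_pbox`: `cellMult D.P c · ψ_x(c) ≤ W_P(x)`. -/
theorem cellMult_le_pbox (hgt : ℤ) (D : Design) (hO : D.OnAlphabet hgt) (x : Fin 4 → Fin 4) (c : Cell) :
    (cellMult D.P c : ℤ) * psi hgt x c ≤ linZ D.P (psi hgt x) := by
  refine cellMult_le_linZ D.P (psi hgt x) (fun cm hcm' hpos' => ?_) c
  obtain ⟨c', m'⟩ := cm
  exact psi_nonneg hgt x c' fun f =>
    hO c' (List.mem_append.2 (Or.inr ((mem_suppP_iff D c').2 ⟨m', hcm', hpos'⟩))) f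

/-- **CAP LAW, per cell.**  On every box of the good class, `cellMult D.P c · ψ_x(c) + 8 ≤ S` for every cell `c`. -/
theorem cap_law_cell (hgt : ℤ) (D : Design) (hO : D.OnAlphabet hgt) (hA : A1e D) (hμ : D.mu ≠ 0) (hM2 : NHubbed hgt D) :
    ∃ k : Fin 4, ∀ x : Fin 4 → Fin 4, wt x = k → ∀ c : Cell,
      (cellMult D.P c : ℤ) * psi hgt x c + 8 ≤ linZ D.P (rho hgt) := by
  obtain ⟨k, hk, -⟩ := pbox_good_class hgt D hO hA hμ hM2
  refine ⟨k, fun x hx c => ?_⟩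
  have h1 := cellMult_le_pbox hgt D hO x c
  have h2 := hk x hx
  linarith

/-- **PAIR LAW, per cell (class-free).** -/
theorem pair_law_cell (hgt : ℤ) (D : Design) (hO : D.OnAlphabet hgt) (hA : A1e D) (hM2 : NHubbed hgt D)
    (x x' : Fin 4 → Fin 4) (hx : wt x' = wt x + 2) (c : Cell) :
    (cellMult D.P c : ℤ) * psi hgt x c + (cellMult D.P c : ℤ) * psi hgt x' c ≤ 2 * linZ D.P (rho hgt) := by
  have h1 := cellMult_le_pbox hgt D hO x c
  have h2 := cellMult_le_pbox hgt D hO x' c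
  have hp := pbox_pair hgt D hA hM2 x x' hx
  linarith

/-- **BOXCAP, per cell.**  For a supported AXIS cell `c`: `16 · cellMult D.P c · ρ(c) + 8 ≤ S`. -/
theorem boxcap_cell (hgt : ℤ) (D : Design) (hO : D.OnAlphabet hgt) (hA : A1e D) (hμ : D.mu ≠ 0) (hM2 : NHubbed hgt D)
    {c : Cell} (hc : c ∈ D.suppP) (hax : AxisCell c) :
    16 * (cellMult D.P c : ℤ) * rho hgt c + 8 ≤ linZ D.P (rho hgt) := by
  obtain ⟨k, hk⟩ := cap_law_cell hgt D hO hA hμ hM2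
  have hsupp : ∀ f : Fin 4, (c f).OnAlphabet hgt := fun f => hO c (List.mem_append.2 (Or.inr hc)) f
  have hpsi : psi hgt (goodBox c k) c = 16 * rho hgt c := psi_goodBox hgt c hsupp hax k
  have h := hk (goodBox c k) (wt_goodBox c k) c
  rw [hpsi] at h
  linarith

end Summit.HodgeConjecture.HodgeConjecture.Cruxes.BlochSeedDiscOne.BoxCap
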